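import Summits.ResolutionOfSingularities.ResolutionOfSingularities.Theorems.FrobeniusLadderFRationalResolutionSubstitutionClosedCentres
import HarnessLib

/-!
# Crux `FrobeniusLadder.FRationalResolution` (stmt-ResolutionOfSingularities-15317), line `redirect`,
# stub `stub_diagonalizableQuotientResolution` — SUBSTITUTION-SAFE rays (lane W‴: intrinsic centres beyond the
# half-open cube, for the `K ≠ K̄` ISOLATED case in dimension `≥ 4`)

`…SubstitutionClosedCentres` (✓ p828058 / p828696, lane W of memo MEMO-15317-leafhand4-g3) showed that the monomial
centre of a fan all of whose new rays are CUBE RAYS (lattice points `v ∈ N` of the half-open unit parallelotope of the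
cone, `0 ≤ v l < 1`) is stable under every weight-respecting substitution `y_l ↦ Σ (monomials of weight c (π l))` — the
shape of the comparison of two quotient-chart structures at an off-diagonal point of the descent datum
(`…DescentDatumLocal.map_includeLeft_le_of_offDiagonal`). The only property of a cube ray used there is the
**substitution inequality** `v l₀ ≤ ⟨u, v⟩` for every exponent `u ∈ ℕⁿ` of weight `c l₀`; this file takes that
inequality itself as the hypothesis ("substitution-safe ray") and records:

* `apply_le_sum_of_weight_eq_of_lt_one` — the cube inequality needs `v l₀ < 1` only AT `l₀` (other coordinates may be
  `≥ 1`); `apply_le_sum_of_weight_eq_of_pos` — a point of `N` in the CLOSED unit cube with all coordinates `> 0` is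
  substitution-safe as soon as the weights are non-zero; `corner_le_sum_of_weight_ne_zero` — in particular the CORNER
  ray `(1,…,1)` (sum of the primitive generators; its star subdivision is the blow-up of the degree-`0` part of a power
  of the irrelevant ideal of the cover `S`, i.e. of an `𝔪`-primary ideal intrinsic to the singularity) is safe;
* `safe_add`, `safe_smul`, `safe_sum` — substitution-safe rays form a convex cone (closed under sums and non-negative
  rational multiples): conflict points of an equivariant star-subdivision ladder may be replaced by their sum;
* `sum_map_le_of_rel_of_safe`, `le_of_rel_of_safe`, **`map_prod_mem_span_of_safe_rays`** — the three substitution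
  statements of `…SubstitutionClosedCentres` with the cube hypotheses `(hN, h0, h1)` replaced by substitution-safety:
  a ring map `θ` with `θ (y l) ∈ (z^{u'} : wt u' = c (π l))` carries every monomial of the centre cut out by order
  conditions on SAFE rays (read through `π`) into the same centre in the other parameters.

Why (design evidence, this session, local script `scratch/ladder.py`, seconds per case): lane W was declared without design in
dimension `≥ 4` because Γ-symmetric regular boundary-sparing fans with CUBE rays do not exist at `1/5(1,2,3,4)`. With
SAFE rays they do: the canonical ladder "star-subdivide the maximal-multiplicity cones at their safe parallelotope rays of
least barycentric key, a Γ-orbit at a time, replacing rays that share a cone by their (safe) sum" terminates in a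
Γ-symmetric (Γ = all weight-permuting symmetries of the cone), boundary-sparing, regular subdivision by iterated star
subdivisions (hence projective) with ALL rays substitution-safe, for EVERY isolated cyclic quotient fourfold singularity
`1/r(w₁,w₂,w₃,w₄)`, `r ≤ 17` (637/637 classes; `1/5(1,2,3,4)`: 5 rounds, 17 rays, 52 cones, first centre = the corner).
Not a theorem here; the consumers (cover comparison W2, the ladder's termination in general) are not in the tree.

Honest label: elementary algebra for a DESIGN (lane W‴ of memo MEMO-15317-leafhand4-g5); no stub closed by name. No
definitions, no named facts, no sorry. [folklore; cite: Fulton1993Toric, §2.6] [cite: KempfEtAl1973, Ch. I §2 Thm. 11]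
-/

-- single-problem summit: the doubled namespace component is forced
set_option linter.dupNamespace false

namespace Summit.ResolutionOfSingularities.ResolutionOfSingularities.Theorems.FRationalResolution.SubstitutionSafeRays

open Finset
open Summit.ResolutionOfSingularities.ResolutionOfSingularities.Theorems.FRationalResolution.SubstitutionClosedCentres

variable {n : ℕ} {A : Type} [AddCommGroup A]

/-! ## Which rays are substitution-safe -/

/-- **Pointwise cube inequality.** Let `c : Fin n → A` be weights, `v` a point of the dual lattice `N` (integral pairing with
every integer exponent of weight `0`) with non-negative coordinates and `v l₀ < 1` (only at `l₀`), and `u ∈ ℕⁿ` an exponent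
of weight `c l₀`. Then `v l₀ ≤ Σ l, u l * v l` (both sides are `≡ v l₀ (mod ℤ)` and the left side is the least
non-negative representative). [folklore; cite: Fulton1993Toric, §2.6] -/
theorem apply_le_sum_of_weight_eq_of_lt_one (c : Fin n → A) (v : Fin n → ℚ)
    (hvN : ∀ m : Fin n → ℤ, ∑ l, m l • c l = 0 → ∃ z : ℤ, ∑ l, (m l : ℚ) * v l = z)
    (hv0 : ∀ l, 0 ≤ v l) (u : Fin n → ℕ) (l₀ : Fin n) (hl₀ : v l₀ < 1)
    (hu : ∑ l, u l • c l = c l₀) :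
    v l₀ ≤ ∑ l, (u l : ℚ) * v l := by
  classical
  -- the integer exponent `u - e_{l₀}` has weight `0`
  have hw : ∑ l, (fun l => (u l : ℤ) - if l = l₀ then 1 else 0) l • c l = 0 := by
    simp only [sub_smul, Finset.sum_sub_distrib, ite_smul, one_smul, zero_smul, Finset.sum_ite_eq',
      Finset.mem_univ, if_true, natCast_zsmul, hu, sub_self]
  obtain ⟨z, hz⟩ := hvN _ hw
  have hz' : ∑ l, (u l : ℚ) * v l - v l₀ = z := by
    rw [← hz]
    simp only [Int.cast_sub, Int.cast_natCast, sub_mul, Finset.sum_sub_distrib]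
    congr 1
    rw [Finset.sum_eq_single l₀]
    · simp
    · intro b _ hb
      simp [hb]
    · intro h
      exact absurd (Finset.mem_univ l₀) h
  have hS : 0 ≤ ∑ l, (u l : ℚ) * v l :=
    Finset.sum_nonneg fun l _ => mul_nonneg (Nat.cast_nonneg _) (hv0 l)
  have hz0 : (0 : ℤ) ≤ z := by
    have h : (-1 : ℚ) < z := by
      rw [← hz']
      linarith
    have h' : (-1 : ℤ) < z := by exact_mod_cast h
    omega
  have hz0' : (0 : ℚ) ≤ z := by exact_mod_cast hz0
  linarith

/-- **An exponent of non-zero weight is non-zero**: if `Σ l, u l • c l = c l₀ ≠ 0` then some `u l ≥ 1`, so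
`1 ≤ Σ l, u l`. [folklore] -/
theorem one_le_sum_of_weight_ne_zero (c : Fin n → A) (u : Fin n → ℕ) (l₀ : Fin n) (hc : c l₀ ≠ 0)
    (hu : ∑ l, u l • c l = c l₀) : (1 : ℚ) ≤ ∑ l, (u l : ℚ) := by
  by_contra h
  rw [not_le] at h
  have hu0 : ∀ l, u l = 0 := by
    intro l
    by_contra hl
    have h1 : (1 : ℚ) ≤ (u l : ℚ) := by exact_mod_cast Nat.one_le_iff_ne_zero.mpr hl
    have h2 : (u l : ℚ) ≤ ∑ l', (u l' : ℚ) :=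
      Finset.single_le_sum (fun l' _ => Nat.cast_nonneg (u l')) (Finset.mem_univ l)
    linarith
  apply hc
  rw [← hu]
  simp [hu0]

/-- **The corner ray is substitution-safe.** For the ray `(1,…,1)` (sum of the primitive generators of the cone) and any
exponent `u` of a NON-ZERO weight `c l₀`: `1 ≤ Σ l, u l * 1`. No lattice hypothesis is needed. (Its star subdivision is the
blow-up of the degree-`0` part of a power of the irrelevant ideal of the cover — an intrinsic `𝔪`-primary centre.)
[folklore; cite: KempfEtAl1973, Ch. I §2] -/
theorem corner_le_sum_of_weight_ne_zero (c : Fin n → A) (u : Fin n → ℕ) (l₀ : Fin n) (hc : c l₀ ≠ 0)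
    (hu : ∑ l, u l • c l = c l₀) :
    (fun _ : Fin n => (1 : ℚ)) l₀ ≤ ∑ l, (u l : ℚ) * (fun _ : Fin n => (1 : ℚ)) l := by
  simp only [mul_one]
  exact one_le_sum_of_weight_ne_zero c u l₀ hc hu

/-- **Closed cube with positive coordinates.** A point `v ∈ N` with `0 < v l ≤ 1` for all `l` is substitution-safe at every
`l₀` of non-zero weight: if `v l₀ < 1` this is the pointwise cube inequality; if `v l₀ = 1` then `⟨u, v⟩ ≡ 1 ≡ 0 (mod ℤ)` is a
positive integer (`u ≠ 0`, all `v l > 0`), hence `≥ 1`. [folklore; cite: Fulton1993Toric, §2.6] -/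
theorem apply_le_sum_of_weight_eq_of_pos (c : Fin n → A) (v : Fin n → ℚ)
    (hvN : ∀ m : Fin n → ℤ, ∑ l, m l • c l = 0 → ∃ z : ℤ, ∑ l, (m l : ℚ) * v l = z)
    (hv0 : ∀ l, 0 < v l) (hv1 : ∀ l, v l ≤ 1) (u : Fin n → ℕ) (l₀ : Fin n) (hc : c l₀ ≠ 0)
    (hu : ∑ l, u l • c l = c l₀) :
    v l₀ ≤ ∑ l, (u l : ℚ) * v l := by
  classical
  rcases (hv1 l₀).lt_or_eq with hlt | heq
  · exact apply_le_sum_of_weight_eq_of_lt_one c v hvN (fun l => (hv0 l).le) u l₀ hlt hu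
  · -- `v l₀ = 1`: the pairing is a positive integer
    have hw : ∑ l, (fun l => (u l : ℤ) - if l = l₀ then 1 else 0) l • c l = 0 := by
      simp only [sub_smul, Finset.sum_sub_distrib, ite_smul, one_smul, zero_smul, Finset.sum_ite_eq',
        Finset.mem_univ, if_true, natCast_zsmul, hu, sub_self]
    obtain ⟨z, hz⟩ := hvN _ hw
    have hz' : ∑ l, (u l : ℚ) * v l - v l₀ = z := by
      rw [← hz]
      simp only [Int.cast_sub, Int.cast_natCast, sub_mul, Finset.sum_sub_distrib]
      congr 1
      rw [Finset.sum_eq_single l₀]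
      · simp
      · intro b _ hb
        simp [hb]
      · intro h
        exact absurd (Finset.mem_univ l₀) h
    -- some `u l₁ ≥ 1`
    have h1 : (1 : ℚ) ≤ ∑ l, (u l : ℚ) := one_le_sum_of_weight_ne_zero c u l₀ hc hu
    obtain ⟨l₁, -, hl₁⟩ : ∃ l₁ ∈ (Finset.univ : Finset (Fin n)), u l₁ ≠ 0 := by
      by_contra hall
      push Not at hall
      have : ∑ l, (u l : ℚ) = 0 := Finset.sum_eq_zero fun l hl => by simp [hall l hl]
      linarith
    -- hence the pairing is `> 0`
    have hpos : 0 < ∑ l, (u l : ℚ) * v l := by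
      have hle : (u l₁ : ℚ) * v l₁ ≤ ∑ l, (u l : ℚ) * v l :=
        Finset.single_le_sum (fun l _ => mul_nonneg (Nat.cast_nonneg (u l)) (hv0 l).le) (Finset.mem_univ l₁)
      have hul : (1 : ℚ) ≤ (u l₁ : ℚ) := by exact_mod_cast Nat.one_le_iff_ne_zero.mpr hl₁
      have : 0 < (u l₁ : ℚ) * v l₁ := mul_pos (by linarith) (hv0 l₁)
      linarith
    -- and `≡ 0 (mod ℤ)`, so `≥ 1`
    have hzpos : (-1 : ℤ) < z := by
      have h : (-1 : ℚ) < z := by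
        rw [← hz', heq]
        linarith
      exact_mod_cast h
    have hz0 : (0 : ℤ) ≤ z := by omega
    have hz0' : (0 : ℚ) ≤ z := by exact_mod_cast hz0
    linarith

/-- Cube rays (`0 ≤ v l < 1` for all `l`) are substitution-safe (`…SubstitutionClosedCentres.apply_le_sum_of_weight_eq`, restated
in the hypothesis shape used below). [folklore; cite: Fulton1993Toric, §2.6] -/
theorem safe_of_cube (c : Fin n → A) (v : Fin n → ℚ)
    (hvN : ∀ m : Fin n → ℤ, ∑ l, m l • c l = 0 → ∃ z : ℤ, ∑ l, (m l : ℚ) * v l = z)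
    (hv0 : ∀ l, 0 ≤ v l) (hv1 : ∀ l, v l < 1) :
    ∀ (u : Fin n → ℕ) (l₀ : Fin n), ∑ l, u l • c l = c l₀ → v l₀ ≤ ∑ l, (u l : ℚ) * v l :=
  fun u l₀ hu => apply_le_sum_of_weight_eq c v hvN hv0 hv1 u l₀ hu

/-! ## Substitution-safe rays form a convex cone -/

/-- **Sums of safe rays are safe** (so two conflicting centres of an equivariant ladder may be replaced by their sum).
[folklore] -/
theorem safe_add (c : Fin n → A) (v w : Fin n → ℚ)
    (hv : ∀ (u : Fin n → ℕ) (l₀ : Fin n), ∑ l, u l • c l = c l₀ → v l₀ ≤ ∑ l, (u l : ℚ) * v l)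
    (hw : ∀ (u : Fin n → ℕ) (l₀ : Fin n), ∑ l, u l • c l = c l₀ → w l₀ ≤ ∑ l, (u l : ℚ) * w l) :
    ∀ (u : Fin n → ℕ) (l₀ : Fin n), ∑ l, u l • c l = c l₀ → (v + w) l₀ ≤ ∑ l, (u l : ℚ) * (v + w) l := by
  intro u l₀ hu
  simp only [Pi.add_apply, mul_add, Finset.sum_add_distrib]
  exact add_le_add (hv u l₀ hu) (hw u l₀ hu)

/-- **Non-negative rational multiples of safe rays are safe.** [folklore] -/
theorem safe_smul (c : Fin n → A) (v : Fin n → ℚ) (q : ℚ) (hq : 0 ≤ q)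
    (hv : ∀ (u : Fin n → ℕ) (l₀ : Fin n), ∑ l, u l • c l = c l₀ → v l₀ ≤ ∑ l, (u l : ℚ) * v l) :
    ∀ (u : Fin n → ℕ) (l₀ : Fin n), ∑ l, u l • c l = c l₀ → (q • v) l₀ ≤ ∑ l, (u l : ℚ) * (q • v) l := by
  intro u l₀ hu
  simp only [Pi.smul_apply, smul_eq_mul]
  have hsum : ∑ l, (u l : ℚ) * (q * v l) = q * ∑ l, (u l : ℚ) * v l := by
    rw [Finset.mul_sum]
    exact Finset.sum_congr rfl fun l _ => by ring
  rw [hsum]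
  exact mul_le_mul_of_nonneg_left (hv u l₀ hu) hq

/-- **Non-negative combinations of safe rays are safe.** [folklore] -/
theorem safe_sum {ι : Type} (s : Finset ι) (c : Fin n → A) (v : ι → Fin n → ℚ) (a : ι → ℚ)
    (ha : ∀ i ∈ s, 0 ≤ a i)
    (hv : ∀ i ∈ s, ∀ (u : Fin n → ℕ) (l₀ : Fin n), ∑ l, u l • c l = c l₀ → v i l₀ ≤ ∑ l, (u l : ℚ) * v i l) :
    ∀ (u : Fin n → ℕ) (l₀ : Fin n), ∑ l, u l • c l = c l₀ →
      (∑ i ∈ s, a i • v i) l₀ ≤ ∑ l, (u l : ℚ) * (∑ i ∈ s, a i • v i) l := by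
  classical
  induction s using Finset.induction_on with
  | empty =>
    intro u l₀ _
    simp
  | @insert i s hi ih =>
    intro u l₀ hu
    rw [Finset.sum_insert hi]
    have hi' := safe_smul c (v i) (a i) (ha i (Finset.mem_insert_self i s))
      (hv i (Finset.mem_insert_self i s))
    have hs' := ih (fun j hj => ha j (Finset.mem_insert_of_mem hj))
      (fun j hj => hv j (Finset.mem_insert_of_mem hj))
    exact safe_add c (a i • v i) (∑ j ∈ s, a j • v j) hi' hs' u l₀ hu

/-! ## Substitution stability of safe-ray centres -/

/-- **A full substitution can only increase the pairing with a safe ray.** If `M` is obtained from the factor list `m` by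
replacing each factor `l` by an exponent of weight `c (π l)` (`Multiset.Rel`), then `Σ_{l ∈ m} v (π l) ≤ ⟨M.sum, v⟩` for every
substitution-safe `v`. [folklore; cite: Fulton1993Toric, §2.6] -/
theorem sum_map_le_of_rel_of_safe (c : Fin n → A) (π : Fin n → Fin n) (v : Fin n → ℚ)
    (hsafe : ∀ (u : Fin n → ℕ) (l₀ : Fin n), ∑ l, u l • c l = c l₀ → v l₀ ≤ ∑ l, (u l : ℚ) * v l)
    {m : Multiset (Fin n)} {M : Multiset (Fin n → ℕ)}
    (hrel : Multiset.Rel (fun l u' => ∑ i, u' i • c i = c (π l)) m M) :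
    ((m.map π).map v).sum ≤ ∑ i, (M.sum i : ℚ) * v i := by
  induction hrel with
  | zero => simp
  | @cons a b as bs hab _ ih =>
    rw [Multiset.map_cons, Multiset.map_cons, Multiset.sum_cons, Multiset.sum_cons]
    have hsplit : ∑ i, ((b + bs.sum) i : ℚ) * v i = ∑ i, (b i : ℚ) * v i + ∑ i, (bs.sum i : ℚ) * v i := by
      rw [← Finset.sum_add_distrib]
      refine Finset.sum_congr rfl fun i _ => ?_
      rw [Pi.add_apply, Nat.cast_add, add_mul]
    rw [hsplit]
    exact add_le_add (hsafe b (π a) hab) ih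

/-- **Safe-ray centres are closed under full substitutions.** With `rays` a set of substitution-safe rays and `f` any function
on them, if the factor list `m` read through `π` satisfies the order conditions `f v ≤ Σ_{l ∈ m} v (π l)` for all `v ∈ rays`,
then so does (the exponent sum of) every full substitution `M` of `m`. [folklore; cite: KempfEtAl1973, Ch. I §2] -/
theorem le_of_rel_of_safe (c : Fin n → A) (π : Fin n → Fin n) (rays : Set (Fin n → ℚ))
    (hsafe : ∀ v ∈ rays, ∀ (u : Fin n → ℕ) (l₀ : Fin n), ∑ l, u l • c l = c l₀ → v l₀ ≤ ∑ l, (u l : ℚ) * v l)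
    (f : (Fin n → ℚ) → ℚ) {m : Multiset (Fin n)} {M : Multiset (Fin n → ℕ)}
    (hrel : Multiset.Rel (fun l u' => ∑ i, u' i • c i = c (π l)) m M)
    (hm : ∀ v ∈ rays, f v ≤ ((m.map π).map v).sum) :
    ∀ v ∈ rays, f v ≤ ∑ i, (M.sum i : ℚ) * v i := fun v hv =>
  (hm v hv).trans (sum_map_le_of_rel_of_safe c π v (hsafe v hv) hrel)

/-- **Substitution stability of safe-ray centres (lane W‴).** Weights `c`, weight permutation `π`, a set `rays` of
substitution-safe rays, order function `f`; a ring map `θ` with `θ (y l) ∈ (z^{u'} : wt u' = c (π l))` for every `l`. Then for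
every factor list `m` whose `π`-reading satisfies the order conditions, `θ (∏_{l ∈ m} y l)` lies in the ideal spanned by the
monomials `z^U` over the exponents `U` satisfying the order conditions. [folklore; cite: KempfEtAl1973, Ch. I §2] -/
theorem map_prod_mem_span_of_safe_rays {E E' : Type} [CommRing E] [CommRing E'] (θ : E →+* E')
    (y : Fin n → E) (z : Fin n → E') (c : Fin n → A) (π : Fin n → Fin n) (rays : Set (Fin n → ℚ))
    (hsafe : ∀ v ∈ rays, ∀ (u : Fin n → ℕ) (l₀ : Fin n), ∑ l, u l • c l = c l₀ → v l₀ ≤ ∑ l, (u l : ℚ) * v l)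
    (f : (Fin n → ℚ) → ℚ)
    (hθ : ∀ l, θ (y l) ∈
      Ideal.span ((fun u : Fin n → ℕ => ∏ i, z i ^ u i) '' {u | ∑ i, u i • c i = c (π l)}))
    (m : Multiset (Fin n)) (hm : ∀ v ∈ rays, f v ≤ ((m.map π).map v).sum) :
    θ (m.map y).prod ∈ Ideal.span ((fun u : Fin n → ℕ => ∏ i, z i ^ u i) ''
      {U | ∀ v ∈ rays, f v ≤ ∑ i, (U i : ℚ) * v i}) :=
  map_prod_mem_span_of_rel θ y z (fun l u' => ∑ i, u' i • c i = c (π l)) hθ m _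
    fun _ hM => le_of_rel_of_safe c π rays hsafe f hM hm

/-- **Corner-and-cube centres are substitution-closed.** The special case most used by the ladder: every ray of `rays` is either
a cube ray of `N` or the corner `(1,…,1)`, and all weights are non-zero. [folklore; cite: KempfEtAl1973, Ch. I §2] -/
theorem map_prod_mem_span_of_cube_or_corner_rays {E E' : Type} [CommRing E] [CommRing E'] (θ : E →+* E')
    (y : Fin n → E) (z : Fin n → E') (c : Fin n → A) (hc : ∀ l, c l ≠ 0) (π : Fin n → Fin n)
    (rays : Set (Fin n → ℚ))
    (hrays : ∀ v ∈ rays, v = (fun _ => (1 : ℚ)) ∨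
      ((∀ m : Fin n → ℤ, ∑ l, m l • c l = 0 → ∃ z : ℤ, ∑ l, (m l : ℚ) * v l = z) ∧
        (∀ l, 0 ≤ v l) ∧ (∀ l, v l < 1)))
    (f : (Fin n → ℚ) → ℚ)
    (hθ : ∀ l, θ (y l) ∈
      Ideal.span ((fun u : Fin n → ℕ => ∏ i, z i ^ u i) '' {u | ∑ i, u i • c i = c (π l)}))
    (m : Multiset (Fin n)) (hm : ∀ v ∈ rays, f v ≤ ((m.map π).map v).sum) :
    θ (m.map y).prod ∈ Ideal.span ((fun u : Fin n → ℕ => ∏ i, z i ^ u i) ''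
      {U | ∀ v ∈ rays, f v ≤ ∑ i, (U i : ℚ) * v i}) := by
  refine map_prod_mem_span_of_safe_rays θ y z c π rays ?_ f hθ m hm
  intro v hv u l₀ hu
  rcases hrays v hv with rfl | ⟨hvN, hv0, hv1⟩
  · exact corner_le_sum_of_weight_ne_zero c u l₀ (hc l₀) hu
  · exact apply_le_sum_of_weight_eq c v hvN hv0 hv1 u l₀ hu


/-! ## Safe rays are constant on weight blocks (appended, leafhand-4 g5)

The linear part of an automorphism of the cover normalizing the grading is block-linear on the variables of equal weight
(`GL` of each weight space), not merely a permutation. For MONOMIAL centres cut out by safe rays this costs nothing: a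
substitution-safe ray takes the same value on any two indices of the same weight (test the safety inequality against the
single-variable exponents `e_{l'}` and `e_l`), so the pairing `⟨u, v⟩` only depends on the block sums of `u` and the centre is
stable under the whole block-linear group. -/

/-- The single-variable exponent `e_{l'}` has weight `c l'`. [folklore] -/
theorem sum_single_smul_eq (c : Fin n → A) (l' : Fin n) :
    ∑ l, (Pi.single l' 1 : Fin n → ℕ) l • c l = c l' := by
  classical
  rw [Finset.sum_eq_single l']
  · simp
  · intro b _ hb
    simp [hb]
  · intro h
    exact absurd (Finset.mem_univ l') h

/-- The pairing of the single-variable exponent `e_{l'}` with `v` is `v l'`. [folklore] -/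
theorem sum_single_mul_eq (v : Fin n → ℚ) (l' : Fin n) :
    ∑ l, ((Pi.single l' 1 : Fin n → ℕ) l : ℚ) * v l = v l' := by
  classical
  rw [Finset.sum_eq_single l']
  · simp
  · intro b _ hb
    simp [hb]
  · intro h
    exact absurd (Finset.mem_univ l') h

/-- **A substitution-safe ray is bounded by every coordinate of the same weight**: if `c l = c l'` then `v l ≤ v l'`
(safety at `l` against the exponent `e_{l'}`). [folklore] -/
theorem apply_le_apply_of_weight_eq (c : Fin n → A) (v : Fin n → ℚ)
    (hsafe : ∀ (u : Fin n → ℕ) (l₀ : Fin n), ∑ l, u l • c l = c l₀ → v l₀ ≤ ∑ l, (u l : ℚ) * v l)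
    {l l' : Fin n} (hll' : c l = c l') : v l ≤ v l' := by
  have h := hsafe (Pi.single l' 1) l (by rw [sum_single_smul_eq, hll'])
  rwa [sum_single_mul_eq] at h

/-- **Substitution-safe rays are constant on weight blocks**: `c l = c l'` implies `v l = v l'`. Hence the pairing
`⟨u, v⟩` with a safe ray depends only on the block sums of `u`, and a monomial centre cut out by order conditions on safe
rays is stable under the block-linear group `∏ GL(S_a ∩ 𝔪/𝔪²)` of the cover, not only under weight permutations.
[folklore] -/
theorem apply_eq_apply_of_weight_eq (c : Fin n → A) (v : Fin n → ℚ)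
    (hsafe : ∀ (u : Fin n → ℕ) (l₀ : Fin n), ∑ l, u l • c l = c l₀ → v l₀ ≤ ∑ l, (u l : ℚ) * v l)
    {l l' : Fin n} (hll' : c l = c l') : v l = v l' :=
  le_antisymm (apply_le_apply_of_weight_eq c v hsafe hll') (apply_le_apply_of_weight_eq c v hsafe hll'.symm)

/-- **Block sums determine the pairing with a safe ray.** If two exponents `u, u'` have the same sum over every weight
block (`Σ_{l : c l = a} u l = Σ_{l : c l = a} u' l` for all `a`, stated as equality of the block sums at every index), then
`⟨u, v⟩ = ⟨u', v⟩` for every substitution-safe `v`. [folklore] -/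
theorem sum_mul_eq_of_blockSum_eq [DecidableEq A] (c : Fin n → A) (v : Fin n → ℚ)
    (hsafe : ∀ (u : Fin n → ℕ) (l₀ : Fin n), ∑ l, u l • c l = c l₀ → v l₀ ≤ ∑ l, (u l : ℚ) * v l)
    (u u' : Fin n → ℕ)
    (hblock : ∀ l₀ : Fin n, ∑ l ∈ Finset.univ.filter (fun l => c l = c l₀), (u l : ℚ) =
      ∑ l ∈ Finset.univ.filter (fun l => c l = c l₀), (u' l : ℚ)) :
    ∑ l, (u l : ℚ) * v l = ∑ l, (u' l : ℚ) * v l := by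
  -- regroup both sums by weight blocks: inside the block of `l₀` the ray is constant `= v l₀`
  have key : ∀ w : Fin n → ℕ, ∑ l, (w l : ℚ) * v l =
      ∑ l₀ ∈ Finset.univ.image c, (∑ l ∈ Finset.univ.filter (fun l => c l = l₀), (w l : ℚ)) *
        (if h : ∃ l, c l = l₀ then v h.choose else 0) := by
    intro w
    rw [← Finset.sum_fiberwise_of_maps_to (s := Finset.univ) (t := Finset.univ.image c) (g := c)
      (fun l hl => Finset.mem_image_of_mem c hl)]
    refine Finset.sum_congr rfl fun a ha => ?_
    obtain ⟨l₁, -, rfl⟩ := Finset.mem_image.mp ha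
    have hex : ∃ l, c l = c l₁ := ⟨l₁, rfl⟩
    rw [dif_pos hex, Finset.sum_mul]
    refine Finset.sum_congr rfl fun l hl => ?_
    rw [Finset.mem_filter] at hl
    rw [apply_eq_apply_of_weight_eq c v hsafe (hl.2.trans hex.choose_spec.symm)]
  rw [key u, key u']
  refine Finset.sum_congr rfl fun a ha => ?_
  obtain ⟨l₁, -, rfl⟩ := Finset.mem_image.mp ha
  rw [hblock l₁]

end Summit.ResolutionOfSingularities.ResolutionOfSingularities.Theorems.FRationalResolution.SubstitutionSafeRays
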